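import Summits.QuantumFields.YangMills.Theses.SqueezedSkewness
import Summits.QuantumFields.YangMills.Theorems.PencilRigidityCurvatureKernelBoundTruncatedAxialPropagation
import HarnessLib

/-!
# Route `SqueezedSkewness`, item `ShellGeometry` (stmt-QuantumFields-27860) — the hypercubic shell test function

`theorem squeezedSkewness_shellGeometry : ShellGeometry`: for every femto radius `0 < ℓ ≤ 1/4` there is a non-negative,
non-zero Schwartz shell `h` supported in the annulus `ℓ ≤ ‖x − e₀‖ ≤ 2ℓ` around the unit-height point `e₀ = (1,0,0,0)`,
invariant under every linear isometry about `e₀` (in particular under the hyperoctahedral group `B₄`), together with the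
three disjointness facts `v ⟂ θv`, `θv ⟂ h`, `v ⟂ h` for every bump `v` of radius `≤ ℓ/2` at `e₀`.

Construction (inside the proof, no new definitions): `h(x) = φ(‖x − e₀‖²)` with `φ` a `ContDiffBump` on `ℝ` centred at
`(3ℓ/2)²` with outer radius `ℓ²/2` (smooth, compactly supported ⇒ Schwartz via `HasCompactSupport.toSchwartzMap`);
radial ⇒ isometry-invariant; `h ≠ 0` forces `7ℓ²/4 < ‖x − e₀‖² < 11ℓ²/4`, inside `(ℓ, 2ℓ)`; disjointness from the sign
of the time coordinate (`tsupport θv ⊆ B̄(−e₀, ℓ/2)`, tree lemma `tsupport_thetaTest_subset_closedBall`) and the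
triangle inequality.

R3/RECORD framing: a SUPPORT item (test-function geometry, folklore); the line's open obligations remain `ShellSign`
(27861) and the descent-bridge cone of `PointlikeMirrorFloors`; NT (19353) and the Yang–Mills mass gap are NOT proved here.
-/

set_option autoImplicit false

namespace Summit.QuantumFields.YangMills.Theorems

open Literature.MathematicalPhysics.QuantumFieldTheory Literature.MathematicalPhysics.QuantumLattice
open Summit.QuantumFields.YangMills.Cruxes.OSLegsFromFemtoAndGap.DlrCollarTransfer
open Summit.QuantumFields.YangMills.Theses.SqueezedSkewness

/-- Time coordinate in a closed ball around `c·e₀`: `c − ρ ≤ y₀`. [folklore] -/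
theorem squeezedSkewness_sub_le_time_of_mem_closedBall {c ρ : ℝ} {y : EuclideanSpace ℝ (Fin 4)}
    (hy : y ∈ Metric.closedBall (EuclideanSpace.single (0 : Fin 4) c) ρ) : c - ρ ≤ y 0 := by
  rw [Metric.mem_closedBall, dist_eq_norm] at hy
  have h1 : |(y - EuclideanSpace.single (0 : Fin 4) c) 0| ≤ ‖y - EuclideanSpace.single (0 : Fin 4) c‖ := by
    have := PiLp.norm_apply_le (p := 2) (y - EuclideanSpace.single (0 : Fin 4) c) 0
    simpa [Real.norm_eq_abs] using this
  have h2 : (y - EuclideanSpace.single (0 : Fin 4) c) 0 = y 0 - c := by simp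
  rw [h2] at h1
  have h3 := (abs_le.mp (h1.trans hy)).1
  linarith

/-- Time coordinate in a closed ball around `c·e₀`: `y₀ ≤ c + ρ`. [folklore] -/
theorem squeezedSkewness_time_le_add_of_mem_closedBall {c ρ : ℝ} {y : EuclideanSpace ℝ (Fin 4)}
    (hy : y ∈ Metric.closedBall (EuclideanSpace.single (0 : Fin 4) c) ρ) : y 0 ≤ c + ρ := by
  rw [Metric.mem_closedBall, dist_eq_norm] at hy
  have h1 : |(y - EuclideanSpace.single (0 : Fin 4) c) 0| ≤ ‖y - EuclideanSpace.single (0 : Fin 4) c‖ := by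
    have := PiLp.norm_apply_le (p := 2) (y - EuclideanSpace.single (0 : Fin 4) c) 0
    simpa [Real.norm_eq_abs] using this
  have h2 : (y - EuclideanSpace.single (0 : Fin 4) c) 0 = y 0 - c := by simp
  rw [h2] at h1
  have h3 := (abs_le.mp (h1.trans hy)).2
  linarith

open Summit.QuantumFields.YangMills.Theorems.CurvatureKernel.AxialPropagation in
/-- **Route `SqueezedSkewness`, item `ShellGeometry` (stmt-QuantumFields-27860).** The radial bump shell
`x ↦ φ(‖x − e₀‖²)` witnesses the geometry package. [folklore] -/
theorem squeezedSkewness_shellGeometry : ShellGeometry := by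
  intro ℓ hℓ hℓ4
  -- the radial profile and the shell function
  let φ : ContDiffBump ((3 * ℓ / 2) ^ 2 : ℝ) := ⟨ℓ ^ 2 / 4, ℓ ^ 2 / 2, by positivity, by nlinarith⟩
  have hrOut : φ.rOut = ℓ ^ 2 / 2 := rfl
  have hrIn : φ.rIn = ℓ ^ 2 / 4 := rfl
  let f : EuclideanSpace ℝ (Fin 4) → ℝ :=
    fun x => φ (‖x - EuclideanSpace.single (0 : Fin 4) (1 : ℝ)‖ ^ 2)
  have hf_apply : ∀ x, f x = φ (‖x - EuclideanSpace.single (0 : Fin 4) (1 : ℝ)‖ ^ 2) := fun x => rfl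
  have hf_smooth : ContDiff ℝ (⊤ : ℕ∞) f :=
    φ.contDiff.comp ((contDiff_norm_sq ℝ).comp (contDiff_id.sub contDiff_const))
  -- where `f ≠ 0`
  have hsq : ∀ x, f x ≠ 0 →
      7 * ℓ ^ 2 / 4 < ‖x - EuclideanSpace.single (0 : Fin 4) (1 : ℝ)‖ ^ 2 ∧
        ‖x - EuclideanSpace.single (0 : Fin 4) (1 : ℝ)‖ ^ 2 < 11 * ℓ ^ 2 / 4 := by
    intro x hx
    have hmem : ‖x - EuclideanSpace.single (0 : Fin 4) (1 : ℝ)‖ ^ 2 ∈ Function.support (φ : ℝ → ℝ) :=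
      Function.mem_support.2 hx
    rw [ContDiffBump.support_eq, Metric.mem_ball, Real.dist_eq, hrOut] at hmem
    have h := abs_lt.mp hmem
    constructor <;> nlinarith [h.1, h.2]
  -- norm bounds where `f ≠ 0`
  have hnorm : ∀ x, f x ≠ 0 →
      ℓ < ‖x - EuclideanSpace.single (0 : Fin 4) (1 : ℝ)‖ ∧
        ‖x - EuclideanSpace.single (0 : Fin 4) (1 : ℝ)‖ < 2 * ℓ := by
    intro x hx
    have hb := hsq x hx
    have hn : 0 ≤ ‖x - EuclideanSpace.single (0 : Fin 4) (1 : ℝ)‖ := norm_nonneg _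
    constructor
    · by_contra hle
      push Not at hle
      have : ‖x - EuclideanSpace.single (0 : Fin 4) (1 : ℝ)‖ ^ 2 ≤ ℓ ^ 2 := by nlinarith [hle, hn]
      nlinarith [hb.1, this]
    · by_contra hle
      push Not at hle
      have h0 : 0 ≤ 2 * ℓ := by linarith
      have : (2 * ℓ) ^ 2 ≤ ‖x - EuclideanSpace.single (0 : Fin 4) (1 : ℝ)‖ ^ 2 := by nlinarith [hle, h0]
      nlinarith [hb.2, this]
  have hf_supp : HasCompactSupport f := by
    refine HasCompactSupport.intro (isCompact_closedBall (EuclideanSpace.single (0 : Fin 4) (1 : ℝ)) (2 * ℓ)) ?_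
    intro x hx
    by_contra hne
    exact hx (by rw [Metric.mem_closedBall, dist_eq_norm]; exact (hnorm x hne).2.le)
  -- the closed annulus containing the support, hence the topological support
  have htsupp : tsupport f ⊆
      {x | ℓ ≤ ‖x - EuclideanSpace.single (0 : Fin 4) (1 : ℝ)‖ ∧
        ‖x - EuclideanSpace.single (0 : Fin 4) (1 : ℝ)‖ ≤ 2 * ℓ} := by
    have hcont : Continuous fun x : EuclideanSpace ℝ (Fin 4) =>
        ‖x - EuclideanSpace.single (0 : Fin 4) (1 : ℝ)‖ := by continuity
    have hK : IsClosed {x : EuclideanSpace ℝ (Fin 4) | ℓ ≤ ‖x - EuclideanSpace.single (0 : Fin 4) (1 : ℝ)‖ ∧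
        ‖x - EuclideanSpace.single (0 : Fin 4) (1 : ℝ)‖ ≤ 2 * ℓ} :=
      (isClosed_le continuous_const hcont).inter (isClosed_le hcont continuous_const)
    refine closure_minimal ?_ hK
    intro x hx
    have hb := hnorm x (Function.mem_support.1 hx)
    exact ⟨hb.1.le, hb.2.le⟩
  -- the Schwartz shell
  refine ⟨hf_supp.toSchwartzMap hf_smooth, ⟨?_, ?_, ?_, ?_⟩, ?_⟩
  · -- non-negativity
    intro x
    exact φ.nonneg
  · -- annulus
    intro x hx
    have hb := htsupp hx
    refine ⟨?_, ?_⟩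
    · rw [Metric.mem_closedBall, dist_eq_norm]; exact hb.2
    · rw [Metric.mem_ball, dist_eq_norm, not_lt]; exact hb.1
  · -- invariance under linear isometries about e₀ (radial profile)
    intro T _ u
    show f (EuclideanSpace.single (0 : Fin 4) (1 : ℝ) + T u) = f (EuclideanSpace.single (0 : Fin 4) (1 : ℝ) + u)
    simp only [hf_apply, add_sub_cancel_left, LinearIsometryEquiv.norm_map]
  · -- non-zero at e₀ + (3ℓ/2)·e₁
    refine ⟨EuclideanSpace.single (0 : Fin 4) (1 : ℝ) + EuclideanSpace.single (1 : Fin 4) (3 * ℓ / 2), ?_⟩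
    show f (EuclideanSpace.single (0 : Fin 4) (1 : ℝ) + EuclideanSpace.single (1 : Fin 4) (3 * ℓ / 2)) ≠ 0
    rw [hf_apply, add_sub_cancel_left, EuclideanSpace.single, PiLp.norm_single, Real.norm_eq_abs, sq_abs]
    have h1 : φ ((3 * ℓ / 2) ^ 2) = 1 :=
      φ.one_of_mem_closedBall (Metric.mem_closedBall_self φ.rIn_pos.le)
    rw [h1]; exact one_ne_zero
  · -- the three disjointness facts for bumps of radius ≤ ℓ/2 at e₀
    intro v hv
    have hθ := tsupport_thetaTest_subset_closedBall (c := (1 : ℝ)) (ρ := ℓ / 2) hv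
    have htsupp' : tsupport ((hf_supp.toSchwartzMap hf_smooth : SchwartzMap (EuclideanSpace ℝ (Fin 4)) ℝ) :
        EuclideanSpace ℝ (Fin 4) → ℝ) ⊆
        {x | ℓ ≤ ‖x - EuclideanSpace.single (0 : Fin 4) (1 : ℝ)‖ ∧
          ‖x - EuclideanSpace.single (0 : Fin 4) (1 : ℝ)‖ ≤ 2 * ℓ} := htsupp
    refine ⟨?_, ?_, ?_⟩
    · rw [Set.disjoint_left]
      intro x hx hx'
      have h1 := squeezedSkewness_sub_le_time_of_mem_closedBall (hv hx)
      have h2 := squeezedSkewness_time_le_add_of_mem_closedBall (hθ hx')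
      linarith
    · rw [Set.disjoint_left]
      intro x hx hx'
      have h1 := squeezedSkewness_time_le_add_of_mem_closedBall (hθ hx)
      have hb := htsupp' hx'
      have hmem : x ∈ Metric.closedBall (EuclideanSpace.single (0 : Fin 4) (1 : ℝ)) (2 * ℓ) := by
        rw [Metric.mem_closedBall, dist_eq_norm]; exact hb.2
      have h2 := squeezedSkewness_sub_le_time_of_mem_closedBall hmem
      linarith
    · rw [Set.disjoint_left]
      intro x hx hx'
      have h1 : ‖x - EuclideanSpace.single (0 : Fin 4) (1 : ℝ)‖ ≤ ℓ / 2 := by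
        have := hv hx
        rwa [Metric.mem_closedBall, dist_eq_norm] at this
      have h2 := (htsupp' hx').1
      linarith

end Summit.QuantumFields.YangMills.Theorems
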